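import Summits.AtomisticToContinuum.BoseEinsteinCondensation.Theorems.BECCutLineWeakDisorderWitnessTransferCoreEntry
import Literature.Probability.RandomPlanarGeometry.PathExitFunctionals
import Literature.Probability.RandomPlanarGeometry.SLETraceApproximation
import Mathlib.Probability.BrownianMotion.Basic
import Mathlib.Probability.Independence.Basic
import HarnessLib

/-!
# Route BECCutLineWeakDisorder — crux `WitnessTransfer`, line `Sketch`, stub (S6): conditioning tools

Generic tools for the conditioning step of (S6): (1) the canonical process of `C([0,∞), ℝ)`
under the law of the path lift of a pre-Brownian motion with continuous paths is pre-Brownian;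
(2) for independent random elements `f, g`, `P((f, g) ∈ S) ≥ p · P(g ∈ G)` as soon as every
section `S_b`, `b ∈ G`, has `P(f ∈ S_b) ≥ p` (product formula); (3) measurability of sets
`{x | ∀ s ≤ t, F x s ≤ B}` for continuous-in-`s` families; (4) measurability of the windowed
integrand `(Q, u) ↦ 𝟙{|u| ≤ 2√t} (min(v, n)𝟙_W)(√((r₀ + 2u)² + Q))` and of the occupation
functional `(u, γ) ↦ ∫₀ᵗ k(2|γ_s|², u_s) ds` on `C([0,∞), ℝ) × C([0,∞), ℝ)³` (Borel σ-algebra of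
the compact-open topology: the tree's scoped instances `PathBorel`).
-/

noncomputable section

open MeasureTheory ProbabilityTheory Filter Set Metric
open scoped ENNReal NNReal Topology

namespace Summit.AtomisticToContinuum.BoseEinsteinCondensation.Theorems.CutLineWitness

open Literature.MathematicalPhysics.QuantumManyBody.BoseGas
open Literature.Probability.Process Literature.Probability.RandomPlanarGeometry

-- Borel σ-algebra of the compact-open topology on `C(ℝ≥0, ℝ)`: the tree's scoped instances
-- `PathBorel.instMeasurableSpaceDrivingPath` / `instBorelSpaceDrivingPath`.
open scoped Literature.Probability.RandomPlanarGeometry.PathBorel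

/-! ### The canonical process under the law of a path lift -/

/-- The evaluations of path space are measurable. [folklore] -/
theorem measurable_pathC_eval (t : ℝ≥0) : Measurable fun u : C(ℝ≥0, ℝ) => u t :=
  (continuous_eval_const (F := C(ℝ≥0, ℝ)) t).measurable

/-- Joint measurability of the evaluation `(u, t) ↦ u t` on path space. [folklore] -/
theorem measurable_pathC_eval₂ : Measurable fun q : C(ℝ≥0, ℝ) × ℝ≥0 => q.1 q.2 :=
  (ContinuousEval.continuous_eval (F := C(ℝ≥0, ℝ))).measurable

/-- **The canonical process under the law of the path lift of a pre-Brownian motion with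
continuous paths is pre-Brownian** (same finite-dimensional laws). [folklore] -/
theorem isPreBrownianReal_eval_map_toPathC {Ω : Type*} [MeasurableSpace Ω] {P : Measure Ω}
    {Y : ℝ≥0 → Ω → ℝ} (hY : IsPreBrownianReal Y P) (hc : ∀ ω, Continuous fun t => Y t ω)
    (hm : ∀ t, Measurable (Y t)) :
    IsPreBrownianReal (fun t (u : C(ℝ≥0, ℝ)) => u t) (P.map (toPathC Y hc)) := by
  have hmI : ∀ I : Finset ℝ≥0, Measurable fun u : C(ℝ≥0, ℝ) => I.restrict fun x => u x := fun I =>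
    (Finset.measurable_restrict I).comp (measurable_pi_lambda _ fun t => measurable_pathC_eval t)
  refine ⟨fun I => ⟨(hmI I).aemeasurable, ?_⟩⟩
  rw [Measure.map_map (hmI I) (measurable_toPathC hc hm)]
  exact (hY.hasLaw I).map_eq

/-! ### Product formula for independent random elements -/

/-- **Sections bound for independent random elements.** If `f ⟂ g`, `S` is measurable and
every section `{a | (a, b) ∈ S}`, `b ∈ G`, has `(P ∘ f⁻¹)`-measure `≥ p`, then
`p · P(g ∈ G) ≤ P((f, g) ∈ S)`. [folklore] -/
theorem mul_map_le_measure_of_indepFun {Ω α β : Type*} [MeasurableSpace Ω] [MeasurableSpace α]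
    [MeasurableSpace β] {P : Measure Ω} [IsProbabilityMeasure P] {f : Ω → α} {g : Ω → β}
    (hf : Measurable f) (hg : Measurable g) (hind : IndepFun f g P) {S : Set (α × β)}
    (hS : MeasurableSet S) {G : Set β} (hG : MeasurableSet G) {p : ℝ≥0∞}
    (hp : ∀ b ∈ G, p ≤ (P.map f) {a | (a, b) ∈ S}) :
    p * (P.map g) G ≤ P {ω | (f ω, g ω) ∈ S} := by
  haveI : IsProbabilityMeasure (P.map f) := Measure.isProbabilityMeasure_map hf.aemeasurable
  haveI : IsProbabilityMeasure (P.map g) := Measure.isProbabilityMeasure_map hg.aemeasurable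
  have hpair : P {ω | (f ω, g ω) ∈ S} = (P.map fun ω => (f ω, g ω)) S := by
    rw [Measure.map_apply (hf.prodMk hg) hS]; rfl
  rw [hpair, (indepFun_iff_map_prod_eq_prod_map_map hf.aemeasurable hg.aemeasurable).1 hind,
    Measure.prod_apply_symm hS]
  calc p * (P.map g) G = ∫⁻ _ in G, p ∂(P.map g) := by rw [setLIntegral_const]
    _ ≤ ∫⁻ b in G, (P.map f) ((fun a => (a, b)) ⁻¹' S) ∂(P.map g) :=
        setLIntegral_mono' hG fun b hb => hp b hb
    _ ≤ ∫⁻ b, (P.map f) ((fun a => (a, b)) ⁻¹' S) ∂(P.map g) := setLIntegral_le_lintegral _ _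

/-! ### Measurable "for all times" sets -/

/-- **`{x | ∀ s ≤ t, F x s ≤ B}` is measurable** when each `x ↦ F x s` is measurable and each
`s ↦ F x s` is continuous (reduce to rational times). [folklore] -/
theorem measurableSet_forall_le_of_continuous {X : Type*} [MeasurableSpace X]
    {F : X → ℝ≥0 → ℝ} (hc : ∀ x, Continuous (F x)) (hm : ∀ s, Measurable fun x => F x s)
    (t : ℝ≥0) (B : ℝ) : MeasurableSet {x | ∀ s ≤ t, F x s ≤ B} := by
  have heq : {x | ∀ s ≤ t, F x s ≤ B} =
      ⋂ q : ℚ, {x | F x (min (max (q : ℝ) 0).toNNReal t) ≤ B} := by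
    ext x
    simp only [mem_setOf_eq, mem_iInter]
    constructor
    · exact fun h q => h _ (min_le_right _ _)
    · intro h s hs
      -- approximate `s` by rationals
      have hsR : ((s : ℝ≥0) : ℝ) ∈ closure (Set.range ((↑) : ℚ → ℝ)) := by
        rw [Rat.denseRange_cast.closure_range]; trivial
      obtain ⟨u, hu, hlim⟩ := mem_closure_iff_seq_limit.1 hsR
      choose q hq using fun n => Set.mem_range.1 (hu n)
      have hcont : Continuous fun r : ℝ => min (max r 0).toNNReal t :=
        (continuous_real_toNNReal.comp (continuous_id.max continuous_const)).min continuous_const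
      have h1 : Tendsto (fun n => ((q n : ℚ) : ℝ)) atTop (𝓝 (s : ℝ)) := by
        simpa only [hq] using hlim
      have h2 : Tendsto (fun n => min (max ((q n : ℚ) : ℝ) 0).toNNReal t) atTop
          (𝓝 (min (max ((s : ℝ≥0) : ℝ) 0).toNNReal t)) := (hcont.tendsto _).comp h1
      have hst : min (max ((s : ℝ≥0) : ℝ) 0).toNNReal t = s := by
        rw [max_eq_left (NNReal.coe_nonneg s), Real.toNNReal_coe, min_eq_left hs]
      rw [hst] at h2
      exact le_of_tendsto (((hc x).tendsto s).comp h2) (Eventually.of_forall fun n => h (q n))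
  rw [heq]
  exact MeasurableSet.iInter fun q => measurableSet_le (hm _) measurable_const

/-! ### The windowed integrand and the occupation functional on path space -/

/-- The windowed one-dimensional integrand is jointly measurable in `(Q, u)`. [folklore] -/
theorem measurable_windowIntegrand {v : ℝ → ℝ≥0∞} (hv : Measurable v) (n : ℕ) (t r₀ : ℝ) :
    Measurable fun p : ℝ × ℝ => indicator {u : ℝ | |u| ≤ 2 * Real.sqrt t} (fun u =>
      indicator (Ioo (r₀ - Real.sqrt t) (r₀ + Real.sqrt t)) (fun r => min (v r) (n : ℝ≥0∞))
        (Real.sqrt ((r₀ + 2 * u) ^ 2 + p.1))) p.2 := by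
  have hh : Measurable (indicator (Ioo (r₀ - Real.sqrt t) (r₀ + Real.sqrt t))
      (fun r => min (v r) (n : ℝ≥0∞))) := (hv.min measurable_const).indicator measurableSet_Ioo
  have hρ : Measurable fun p : ℝ × ℝ => Real.sqrt ((r₀ + 2 * p.2) ^ 2 + p.1) := by fun_prop
  have hg : Measurable fun p : ℝ × ℝ => indicator (Ioo (r₀ - Real.sqrt t) (r₀ + Real.sqrt t))
      (fun r => min (v r) (n : ℝ≥0∞)) (Real.sqrt ((r₀ + 2 * p.2) ^ 2 + p.1)) := hh.comp hρ
  have hA : MeasurableSet {p : ℝ × ℝ | |p.2| ≤ 2 * Real.sqrt t} :=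
    measurableSet_le (measurable_snd.abs) measurable_const
  have heq : (fun p : ℝ × ℝ => indicator {u : ℝ | |u| ≤ 2 * Real.sqrt t} (fun u =>
      indicator (Ioo (r₀ - Real.sqrt t) (r₀ + Real.sqrt t)) (fun r => min (v r) (n : ℝ≥0∞))
        (Real.sqrt ((r₀ + 2 * u) ^ 2 + p.1))) p.2) = fun p => if |p.2| ≤ 2 * Real.sqrt t then
      indicator (Ioo (r₀ - Real.sqrt t) (r₀ + Real.sqrt t)) (fun r => min (v r) (n : ℝ≥0∞))
        (Real.sqrt ((r₀ + 2 * p.2) ^ 2 + p.1)) else 0 := by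
    funext p
    simp only [Set.indicator_apply (s := {u : ℝ | |u| ≤ 2 * Real.sqrt t}), Set.mem_setOf_eq]
  rw [heq]
  exact Measurable.ite hA hg measurable_const

/-- **The occupation functional on path space is measurable**:
`(u, γ) ↦ ∫_{(0,t]} k(2∑_l γ_l(s∧t)², u_s) ds` on `C([0,∞),ℝ) × C([0,∞),ℝ)³`. [folklore] -/
theorem measurable_pathOccupation {v : ℝ → ℝ≥0∞} (hv : Measurable v) (n : ℕ) (t r₀ : ℝ) :
    Measurable fun p : C(ℝ≥0, ℝ) × (Fin 3 → C(ℝ≥0, ℝ)) => ∫⁻ s in Ioc 0 t,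
      indicator {u : ℝ | |u| ≤ 2 * Real.sqrt t} (fun u =>
        indicator (Ioo (r₀ - Real.sqrt t) (r₀ + Real.sqrt t)) (fun r => min (v r) (n : ℝ≥0∞))
          (Real.sqrt ((r₀ + 2 * u) ^ 2 + 2 * ∑ l, (p.2 l (min s t).toNNReal) ^ 2))) (p.1 s.toNNReal) := by
  have hK := measurable_windowIntegrand hv n t r₀
  -- `(p, s) ↦ (Q, u)` is measurable
  have hu : Measurable fun q : (C(ℝ≥0, ℝ) × (Fin 3 → C(ℝ≥0, ℝ))) × ℝ => q.1.1 q.2.toNNReal :=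
    measurable_pathC_eval₂.comp (measurable_fst.fst.prodMk (measurable_real_toNNReal.comp measurable_snd))
  have hγ : ∀ l : Fin 3, Measurable fun q : (C(ℝ≥0, ℝ) × (Fin 3 → C(ℝ≥0, ℝ))) × ℝ =>
      q.1.2 l (min q.2 t).toNNReal := by
    intro l
    have hg : Measurable fun q : (C(ℝ≥0, ℝ) × (Fin 3 → C(ℝ≥0, ℝ))) × ℝ =>
        (q.1.2 l, (min q.2 t).toNNReal) :=
      ((measurable_pi_apply l).comp (measurable_snd.comp measurable_fst)).prodMk
        (measurable_real_toNNReal.comp (measurable_snd.min measurable_const))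
    exact measurable_pathC_eval₂.comp hg
  have hQ : Measurable fun q : (C(ℝ≥0, ℝ) × (Fin 3 → C(ℝ≥0, ℝ))) × ℝ =>
      2 * ∑ l, (q.1.2 l (min q.2 t).toNNReal) ^ 2 :=
    (Finset.measurable_sum _ fun l _ => (hγ l).pow_const 2).const_mul _
  have hF := hK.comp (hQ.prodMk hu)
  exact Measurable.lintegral_prod_right (f := fun p s => _) hF

end Summit.AtomisticToContinuum.BoseEinsteinCondensation.Theorems.CutLineWitness

end
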